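import Mathlib.RingTheory.Artinian.Module
import Mathlib.RingTheory.Artinian.Ring
import Mathlib.RingTheory.TotallySplit
import Mathlib.RingTheory.TensorProduct.Basic
import Mathlib.LinearAlgebra.FreeModule.Finite.Matrix
import Mathlib.LinearAlgebra.Dimension.Constructions
import Mathlib.FieldTheory.IsAlgClosed.Basic
import HarnessLib

/-!
# The number of geometric points of a finite free algebra: `#Hom_V(A, Ω) ≤ rank_V A`, with equality iff the
# geometric fibre `Ω ⊗_V A` is reduced ([StacksProject 0CKL, 09HS, 00U3]; [GortzWedhorn2020] Prop. 3.33, §(4.1))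

Topic `Literature/RingTheory/Etale`; namespace `Literature.RingTheory.Etale`.  PROOF FILE (theorems only; no definition, no named
fact, no instance, no `sorry`; Mathlib-only imports).  Cell `hodgecm-mathlib` (D-0151), FLOOR 0, programme F0P5a, piece **(γ2-alg)(i)** of
the (S-γ) bridge «specialisation of the geometric fibres of a finite flat cover under the reduction map» (F0P5a-p02 (g2) 2026-08-31,
LEAD WORDS #11∕#12; consumer (γ2) `Motives/FiniteFlatCoverReductionMultiset`): the POINT COUNT of a finite free algebra.

SETTING.  `V` a commutative ring, `A` a commutative `V`-algebra which is module-finite and FREE of rank `d = finrank_V A` (e.g. the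
coordinate ring of the pull-back of a finite flat cover `𝒯 → 𝒮` along a point `Spec V → 𝒮` of a valuation ring `V`, or a local corner of it),
`Ω` a field under `V` (e.g. the algebraically closed fraction field of `V`).  The `Ω`-valued points of `A` over `V` are the `V`-algebra maps
`A →ₐ[V] Ω`, equivalently (`AlgHom.liftEquiv`) the `Ω`-points `Ω ⊗_V A →ₐ[Ω] Ω` of the geometric fibre.

RESULTS.
* §1 `card_algHom_le_finrank_of_free` — `#(A →ₐ[V] Ω) ≤ d` for ANY field (indeed domain) `Ω` (Dedekind's independence of characters,
  Mathlib `card_algHom_le_finrank`), the set of points being finite (Mathlib `Finite.algHom`).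
* §2 (over an algebraically closed field `Ω`) `exists_algEquiv_pi_of_isReduced` — a finite-dimensional REDUCED commutative `Ω`-algebra `B`
  is SPLIT: `B ≃ₐ[Ω] (MaximalSpectrum B → Ω)` (Artin: `B ≃ Π_𝔪 B∕𝔪`, Mathlib `IsArtinianRing.equivPi`; each residue field is a finite, hence
  trivial, extension of `Ω`, Mathlib `IsAlgClosed.algebraMap_bijective_of_isIntegral`); hence `isFiniteSplit_of_isReduced` and
  **`card_algHom_eq_finrank_of_isReduced`: `#(B →ₐ[Ω] Ω) = finrank_Ω B`** (`card_algHom_pi`: the points of `Ω^ι` are the `#ι` evaluations).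
* §3 `card_algHom_eq_finrank_of_isReduced_baseChange` — **`#(A →ₐ[V] Ω) = d` as soon as the geometric fibre `Ω ⊗_V A` is reduced**
  (`Ω` algebraically closed; `finrank_Ω (Ω ⊗_V A) = finrank_V A`, Mathlib `Module.finrank_baseChange`); `…_baseChange'` the same with
  `A ⊗_V Ω`.  In characteristic `0` (or whenever `Frac V → Ω` is separable) «reduced» = «étale generic fibre», the hypothesis of (γ2).
  Locality of `A` is NOT needed: the statement applies verbatim to every local corner `A_𝔪` of the decomposition `A ≃ Π_𝔪 A_𝔪` of (γ1a)
  and sums to `d = Σ_𝔪 d_𝔪`.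

Ours (formalisation glue over Mathlib); axioms `propext`, `Classical.choice`, `Quot.sound`.

## References
* [StacksProject] The Stacks Project, Tag 0CKL (Fields Lemma 9.13.1: linear independence of characters), Tag 09HS (Fields Lemma 9.15.9:
  `#Mor_F(E, F̄) ≤ [E : F]`), Tag 00U3 (Algebra Lemma 10.143.4: étale algebras over a field are finite products of finite separable
  extensions; over a separably closed field they split).
* [GortzWedhorn2020] U. Görtz, T. Wedhorn, *Algebraic Geometry I* (2nd ed. 2020), Prop. 3.33 (closed points ⇔ finite residue field) and
  §(4.1) (functors attached to schemes: `X(Ω) = Hom_k(Γ(X), Ω)` for affine `X`).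
-/

set_option autoImplicit false

noncomputable section

open TensorProduct

namespace Literature.RingTheory.Etale

universe u v w

/-! ## §1 The upper bound `#(A →ₐ[V] Ω) ≤ rank` (any domain `Ω`) -/

section UpperBound

variable (V : Type u) [CommRing V] (A : Type v) [CommRing A] [Algebra V A] [Module.Finite V A] [Module.Free V A]
  (Ω : Type w) [CommRing Ω] [IsDomain Ω] [Algebra V Ω]

/-- **`#(A →ₐ[V] Ω) ≤ finrank_V A`** for a module-finite free commutative `V`-algebra `A` and a domain `Ω` under `V`: distinct `V`-algebra
maps `A → Ω` are `Ω`-linearly independent characters (Dedekind; Mathlib `card_algHom_le_finrank`). [cite: StacksProject, Tag 0CKL and Tag 09HS] -/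
theorem card_algHom_le_finrank_of_free : Nat.card (A →ₐ[V] Ω) ≤ Module.finrank V A :=
  card_algHom_le_finrank V A Ω

/-- The set of `Ω`-valued points `A →ₐ[V] Ω` of a module-finite free algebra is FINITE (Mathlib `Finite.algHom`).
[cite: StacksProject, Tag 0CKL and Tag 09HS] -/
theorem finite_algHom_of_free : Finite (A →ₐ[V] Ω) :=
  Finite.algHom V A Ω

end UpperBound

/-! ## §2 Finite-dimensional reduced algebras over an algebraically closed field are split -/

section Split

variable (Ω : Type u) [Field Ω] (B : Type v) [CommRing B] [Algebra Ω B] [Module.Finite Ω B]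

/-- **The points of `Ω^ι` are the evaluations**: for a field `Ω` and a finite index type `ι`, `#((ι → Ω) →ₐ[Ω] Ω) = #ι`.  (Lower bound: the
evaluations `ev_i` are pairwise distinct — they differ on the idempotent `e_i`; upper bound: Dedekind, `finrank_Ω Ω^ι = #ι`.)
[cite: StacksProject, Tag 0CKL and Tag 09HS] [cite: GortzWedhorn2020, Prop. 3.33 and §(4.1)] -/
theorem card_algHom_pi (ι : Type v) [Finite ι] : Nat.card ((ι → Ω) →ₐ[Ω] Ω) = Nat.card ι := by
  classical
  letI : Fintype ι := Fintype.ofFinite ι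
  refine le_antisymm ?_ ?_
  · calc Nat.card ((ι → Ω) →ₐ[Ω] Ω) ≤ Module.finrank Ω (ι → Ω) := card_algHom_le_finrank Ω (ι → Ω) Ω
      _ = Nat.card ι := by rw [Module.finrank_fintype_fun_eq_card, Nat.card_eq_fintype_card]
  · haveI : Finite ((ι → Ω) →ₐ[Ω] Ω) := Finite.algHom Ω (ι → Ω) Ω
    refine Nat.card_le_card_of_injective (fun i => Pi.evalAlgHom Ω (fun _ : ι => Ω) i) fun i j hij => ?_
    by_contra hne
    have h := congrArg (fun φ : (ι → Ω) →ₐ[Ω] Ω => φ (Pi.single i 1)) hij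
    simp only [Pi.evalAlgHom_apply, Pi.single_eq_same, Pi.single_eq_of_ne' hne] at h
    exact one_ne_zero h

variable [IsAlgClosed Ω] [IsReduced B]

/-- **A finite-dimensional REDUCED commutative algebra over an algebraically closed field is SPLIT**: `B ≃ₐ[Ω] (MaximalSpectrum B → Ω)`.
`B` is Artinian and reduced, so `B ≃ Π_𝔪 B∕𝔪` (Mathlib `IsArtinianRing.equivPi`); each `B∕𝔪` is a field, finite over the algebraically
closed `Ω`, hence `= Ω` (Mathlib `IsAlgClosed.algebraMap_bijective_of_isIntegral`). [cite: StacksProject, Tag 00U3]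
[cite: GortzWedhorn2020, Prop. 3.33 and §(4.1)] -/
theorem exists_algEquiv_pi_of_isReduced : Nonempty (B ≃ₐ[Ω] (MaximalSpectrum B → Ω)) := by
  haveI : IsArtinianRing B := IsArtinianRing.of_finite Ω B
  -- `B ≃ Π_𝔪 B ∕ 𝔪` as `Ω`-algebras
  let e₁ : B ≃ₐ[Ω] (∀ I : MaximalSpectrum B, B ⧸ I.asIdeal) := (IsArtinianRing.equivPi B).restrictScalars Ω
  -- each residue field is `Ω`
  have e₂ : ∀ I : MaximalSpectrum B, (B ⧸ I.asIdeal) ≃ₐ[Ω] Ω := fun I => by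
    haveI : I.asIdeal.IsMaximal := I.isMaximal
    haveI : Algebra.IsIntegral Ω (B ⧸ I.asIdeal) := Algebra.IsIntegral.of_finite Ω _
    exact (AlgEquiv.ofBijective (Algebra.ofId Ω (B ⧸ I.asIdeal))
      (IsAlgClosed.algebraMap_bijective_of_isIntegral (k := Ω) (K := B ⧸ I.asIdeal))).symm
  exact ⟨e₁.trans (AlgEquiv.piCongrRight e₂)⟩

/-- Hence such a `B` is FINITE SPLIT over `Ω` (Mathlib `Algebra.IsFiniteSplit`: `B ≃ₐ[Ω] (Fin n → Ω)`). [cite: StacksProject, Tag 00U3] -/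
theorem isFiniteSplit_of_isReduced : Algebra.IsFiniteSplit Ω B := by
  haveI : IsArtinianRing B := IsArtinianRing.of_finite Ω B
  obtain ⟨e⟩ := exists_algEquiv_pi_of_isReduced Ω B
  exact Algebra.IsFiniteSplit.of_algEquiv e.symm

/-- **`#(B →ₐ[Ω] Ω) = finrank_Ω B`** for a finite-dimensional reduced commutative algebra `B` over an algebraically closed field `Ω`: both
sides are `#MaximalSpectrum B` through the splitting `B ≃ Ω^{MaximalSpectrum B}` (`card_algHom_pi`). [cite: StacksProject, Tag 00U3]
[cite: GortzWedhorn2020, Prop. 3.33 and §(4.1)] -/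
theorem card_algHom_eq_finrank_of_isReduced : Nat.card (B →ₐ[Ω] Ω) = Module.finrank Ω B := by
  classical
  haveI : IsArtinianRing B := IsArtinianRing.of_finite Ω B
  letI : Fintype (MaximalSpectrum B) := Fintype.ofFinite _
  obtain ⟨e⟩ := exists_algEquiv_pi_of_isReduced Ω B
  rw [Nat.card_congr (AlgEquiv.arrowCongr e AlgEquiv.refl), card_algHom_pi, e.toLinearEquiv.finrank_eq,
    Module.finrank_fintype_fun_eq_card, Nat.card_eq_fintype_card]

end Split

/-! ## §3 Equality `#(A →ₐ[V] Ω) = rank` when the geometric fibre is reduced -/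

section Equality

variable (V : Type u) [CommRing V] (A : Type v) [CommRing A] [Algebra V A] [Module.Finite V A] [Module.Free V A]
  (Ω : Type w) [Field Ω] [Algebra V Ω]

omit [Module.Finite V A] [Module.Free V A] in
/-- The `Ω`-valued points of `A` over `V` are the `Ω`-points of the geometric fibre `Ω ⊗_V A` (base-change adjunction, Mathlib
`AlgHom.liftEquiv`): `#(A →ₐ[V] Ω) = #(Ω ⊗_V A →ₐ[Ω] Ω)`. [cite: GortzWedhorn2020, §(4.1)] -/
theorem card_algHom_eq_card_algHom_baseChange : Nat.card (A →ₐ[V] Ω) = Nat.card (Ω ⊗[V] A →ₐ[Ω] Ω) :=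
  Nat.card_congr (AlgHom.liftEquiv V Ω A Ω)

variable [IsAlgClosed Ω]

/-- **THE GEOMETRIC POINT COUNT: `#(A →ₐ[V] Ω) = finrank_V A` when the geometric fibre `Ω ⊗_V A` is REDUCED** (`A` module-finite free
over the commutative ring `V`, `Ω` an algebraically closed field under `V`; for `V` a valuation ring with fraction field inside `Ω` of
characteristic `0` this is «the generic fibre is étale»).  PROOF: §2 at `B := Ω ⊗_V A` (finite-dimensional of dimension `finrank_V A`,
Mathlib `Module.finrank_baseChange`) and the base-change adjunction.  Applies verbatim to every local corner of `A`.
[cite: StacksProject, Tag 00U3 and Tag 09HS] [cite: GortzWedhorn2020, Prop. 3.33 and §(4.1)] -/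
theorem card_algHom_eq_finrank_of_isReduced_baseChange [IsReduced (Ω ⊗[V] A)] :
    Nat.card (A →ₐ[V] Ω) = Module.finrank V A := by
  haveI : Nontrivial V := (algebraMap V Ω).domain_nontrivial
  rw [card_algHom_eq_card_algHom_baseChange V A Ω, card_algHom_eq_finrank_of_isReduced Ω (Ω ⊗[V] A),
    Module.finrank_baseChange]

/-- The same with the geometric fibre written `A ⊗_V Ω` (Mathlib `Algebra.TensorProduct.comm`). [cite: StacksProject, Tag 00U3] -/
theorem card_algHom_eq_finrank_of_isReduced_baseChange' [IsReduced (A ⊗[V] Ω)] :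
    Nat.card (A →ₐ[V] Ω) = Module.finrank V A := by
  haveI : IsReduced (Ω ⊗[V] A) :=
    isReduced_of_injective (Algebra.TensorProduct.comm V Ω A).toRingHom (Algebra.TensorProduct.comm V Ω A).injective
  exact card_algHom_eq_finrank_of_isReduced_baseChange V A Ω

/-- `Fintype` reading of the point count (any `Fintype` structure on the finite set of points). [cite: StacksProject, Tag 00U3] -/
theorem fintypeCard_algHom_eq_finrank_of_isReduced_baseChange [IsReduced (Ω ⊗[V] A)] [Fintype (A →ₐ[V] Ω)] :
    Fintype.card (A →ₐ[V] Ω) = Module.finrank V A := by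
  rw [← Nat.card_eq_fintype_card, card_algHom_eq_finrank_of_isReduced_baseChange V A Ω]

end Equality

end Literature.RingTheory.Etale

end
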